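import Summits.QuantumFields.YangMills.Theorems.SteinGapBootstrapFreeProbeLawGAssemblyBackground
import HarnessLib

/-!
# Crux U `FreeProbeLawG` (stmt-QuantumFields-23756), line `birth` — assembly part A3d(ii): the raw bound at fixed `β, μ, R, δ, λ`

Lead `ym-line-sgb-k1-g1`; helper toward the registered stub `stub_assembly`. All inputs of the line at a fixed inverse coupling `β ≥ 1`
and a fixed torus-limit state `μ` — the single-edge Schwinger–Dyson identities with rate (stub `stub_sdRate`), the truncated Green `1`-forms
(stub `stub_blockGreen`), the field bounds (stub `stub_fieldBounds`) and the sharp budget (stub `stub_budgetRate`) — are combined, for a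
truncation radius `R ≥ 2n + 2`, a Gaussian-weight scale `0 < δ ≤ 1` and an AM–GM parameter `λ > 0`, into an explicit bound on the
Ornstein–Uhlenbeck generator discrepancy of the pair law (`raw_bound`): boxes (`Resum`), truncated Green `1`-forms, the background bound per
block plaquette (`AssemblyBackground.background_bound`) and the generator step (`AssemblyGen`). The choice of `R, δ, λ` as powers of `β` is
made in the final file. HONEST LABEL: RECORD rung R2ξ-G only; nothing here bears on the Yang–Mills mass gap.
References: E. Meckes, IMS Coll. 5 (2009), Lemma 1 [Meckes2009]; S. Chatterjee, arXiv:1602.01222, §11 [arXiv160201222].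
-/

set_option autoImplicit false

noncomputable section

open MeasureTheory Finset
open Literature.Probability.LatticeModels Literature.MathematicalPhysics.QuantumLattice
open Literature.MathematicalPhysics.QuantumFieldTheory hiding ZdEdge IsLocalObservable IsInfiniteVolumeLimit
open Summit.QuantumFields.YangMills.Theorems.EquipartitionPinsProbe

namespace Summit.QuantumFields.YangMills.Cruxes.FreeProbeLawG.SteinFree

namespace AssemblyMain

open AssemblyBackground

variable {G : Type} [Group G] [TopologicalSpace G] [IsTopologicalGroup G] [CompactSpace G]
  [MeasurableSpace G] [BorelSpace G] [SecondCountableTopology G]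
set_option maxHeartbeats 400000 in
/-- **The raw bound.** See the module docstring. -/
theorem raw_bound (r : LatticeRep G) {β : ℝ} (hβ1 : 1 ≤ β) (μ : Measure (LGConfig 4 G)) [IsProbabilityMeasure μ]
    -- single-edge Schwinger–Dyson with rate, at `(β, μ)`
    {Csd csd κsd : ℝ} (hCsd : 0 ≤ Csd)
    (hSDβ : ∀ (e : ZdEdge 4) (b : Fin (lieDim r)) (S : Finset (ZdPlaquette 4)) (ρS : ℕ),
      plaquettesTouching {e} ⊆ S → (∀ p ∈ S, ∀ k : Fin 4, |p.1 k| ≤ (ρS : ℤ)) →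
      ∀ (g : (↥S → Fin (lieDim r) → ℝ) → ℝ) (M : ℝ), 0 ≤ M → ContDiff ℝ 1 g →
        (∀ y, |g y| ≤ 1) → (∀ y, ‖fderiv ℝ g y‖ ≤ M) →
        |(∑ p : ↥S, plaquetteCurl (fun e' => if e' = e then (1 : ℝ) else 0) (p : ZdPlaquette 4) *
              ∫ U, fderiv ℝ g (fun q a => plaqField r β U (q : ZdPlaquette 4) a)
                (fun q a => if q = p ∧ a = b then (1 : ℝ) else 0) ∂μ) -
            ∫ U, g (fun q a => plaqField r β U (q : ZdPlaquette 4) a) *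
              (∑ p ∈ S, plaquetteCurl (fun e' => if e' = e then (1 : ℝ) else 0) p * plaqField r β U p b) ∂μ| ≤
          Csd * (1 + M) * (1 + (ρS : ℝ)) ^ csd * β ^ (-κsd))
    -- truncated Green `1`-forms
    {Cg cg γ : ℝ} (hCg : 0 ≤ Cg)
    (hGreen : ∀ (p : ZdPlaquette 4) (R : ℕ), (∀ k : Fin 4, 2 * |p.1 k| + 2 ≤ (R : ℤ)) →
      ∃ ω : ZdEdge 4 → ℝ,
        (∀ e, ω e ≠ 0 → ∀ k : Fin 4, |e.1 k| ≤ (R : ℤ)) ∧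
        (∀ T : Finset (ZdEdge 4), ∑ e ∈ T, |ω e| ≤ Cg * (1 + (R : ℝ)) ^ cg) ∧
        (∀ q : ZdPlaquette 4, (∀ k : Fin 4, 2 * |q.1 k| + 2 ≤ (R : ℤ)) → plaquetteCurl ω q = curvatureTwoPoint p q) ∧
        (∀ T : Finset (ZdPlaquette 4), (∀ q, plaquetteCurl ω q ≠ 0 → q ∈ T) →
          |(∑ q ∈ T, (plaquetteCurl ω q) ^ 2) - curvatureTwoPoint p p| ≤ Cg * (1 + (R : ℝ)) ^ (-γ)))
    -- field bounds at `(β, μ)`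
    (hFa : ∀ (x : Site 4), (∀ k : Fin 4, k ≠ 0 → x k = 0) → ∀ U : LGConfig 4 G,
      ∑ a : Fin (lieDim r), (plaqField r β U (plaquette12 (d := 4) (by norm_num) x) a) ^ 2 ≤
        2 * β * ((r.N : ℝ) - plaquetteObs r.ρ x 1 2 U))
    {Cm cm : ℝ} (hCm : 0 ≤ Cm) (hcm : 0 ≤ cm)
    (hFb : ∀ (p : ZdPlaquette 4) (a : Fin (lieDim r)),
      Integrable (fun U => (plaqField r β U p a) ^ 2) μ ∧
      ∫ U, (plaqField r β U p a) ^ 2 ∂μ ≤ Cm * (1 + ∑ k : Fin 4, (|p.1 k| : ℝ)) ^ cm)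
    -- the budget at `(β, μ)`
    {Cb κ : ℝ}
    (hbud : ∀ (x : Site 4) (i j : Fin 4), i ≠ j →
      |β * (∫ U, ((r.N : ℝ) - plaquetteObs r.ρ x i j U) ∂μ) - (lieDim r : ℝ) / 4| ≤ Cb * β ^ (-κ))
    -- the pair block and the test function
    (n : ℕ) (B : Finset (ZdPlaquette 4))
    (hB : B = {plaquette12 (d := 4) (by norm_num) 0, plaquette12 (d := 4) (by norm_num) (Pi.single (0 : Fin 4) (n : ℤ))})
    (F : (↥B → Fin (lieDim r) → ℝ) → ℝ) {M : ℝ} (hM : 0 ≤ M) (hF : ContDiff ℝ 2 F)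
    (hF1 : ∀ x, ‖fderiv ℝ F x‖ ≤ 1) (hF2 : ∀ x y, ‖fderiv ℝ F x - fderiv ℝ F y‖ ≤ M * ‖x - y‖)
    -- the free parameters
    (R : ℕ) (hR : 2 * n + 2 ≤ R) {δ : ℝ} (hδ : 0 < δ) (hδ1 : δ ≤ 1) {lam : ℝ} (hlam : 0 < lam) :
    |∫ U, latticeMaxwellBlockGenerator B (lieDim r) F (fun p a => plaqField r β U (p : ZdPlaquette 4) a) ∂μ| ≤
      2 * (lieDim r : ℝ) *
        ((Cg * (1 + (R : ℝ)) ^ cg) * ((Csd * (2 + (R : ℝ)) ^ csd * β ^ (-κsd)) * (1 + M)) +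
          (lam * (2 * |Cb| * β ^ (-κ) +
              3 * (lieDim r : ℝ) *
                ((Cg * (1 + (R : ℝ)) ^ cg) * ((Csd * (2 + (R : ℝ)) ^ csd * β ^ (-κsd)) *
                    (δ ^ (-(1 / 2 : ℝ)) + ((lieDim r : ℝ) + 2) * (1 + 4000 * Cg * (1 + (R : ℝ)) ^ (cg + 4)))) +
                  3 * (Cg * (1 + (R : ℝ)) ^ (-γ))) +
              1 / 2 * δ *
                ((lieDim r : ℝ) * (Cm * (5 * (1 + (R : ℝ))) ^ cm) * (2 + 3 * (4000 * Cg * (1 + (R : ℝ)) ^ (cg + 4)) ^ 2)) *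
                ((lieDim r : ℝ) / 2 + 1)) +
            lam⁻¹ +
            Real.sqrt δ *
              ((lieDim r : ℝ) * (Cm * (5 * (1 + (R : ℝ))) ^ cm) * (2 + 3 * (4000 * Cg * (1 + (R : ℝ)) ^ (cg + 4)) ^ 2)))) := by
  classical
  have hβ0 : 0 < β := lt_of_lt_of_le one_pos hβ1
  have hR0 : (0 : ℝ) ≤ R := Nat.cast_nonneg R
  have hD0 : (0 : ℝ) ≤ lieDim r := Nat.cast_nonneg _
  -- integrability via continuity on the compact configuration space
  have hint : ∀ {f : LGConfig 4 G → ℝ}, Continuous f → Integrable f μ := fun hf =>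
    AssemblyCore.integrable_of_continuous_bdd μ hf
  have hYqc : ∀ (q : ZdPlaquette 4) (a : Fin (lieDim r)), Continuous fun U : LGConfig 4 G => plaqField r β U q a :=
    fun q a => TangentPlaqFieldContinuous.continuous_plaqField_apply r β q a
  /- ### boxes -/
  obtain ⟨E, hEmem, -⟩ := Resum.exists_edgeBox R
  obtain ⟨S, hSmem, hScard⟩ := Resum.exists_plaqBox (R + 1)
  have hSrad : ∀ q ∈ S, ∀ k : Fin 4, |q.1 k| ≤ ((R + 1 : ℕ) : ℤ) := fun q hq k => (hSmem q).1 hq k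
  have hSmem' : ∀ q : ZdPlaquette 4, (∀ k : Fin 4, |q.1 k| ≤ (R : ℤ) + 1) → q ∈ S := fun q hq =>
    (hSmem q).2 fun k => by push_cast; exact hq k
  have hBcore : ∀ p ∈ B, ∀ k : Fin 4, 2 * |p.1 k| + 2 ≤ (R : ℤ) := by
    intro p hp k
    rw [hB, Finset.mem_insert, Finset.mem_singleton] at hp
    have hR' : 2 * (n : ℤ) + 2 ≤ (R : ℤ) := by exact_mod_cast hR
    rcases hp with rfl | rfl
    · simp only [plaquette12, Pi.zero_apply, abs_zero, mul_zero, zero_add]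
      linarith
    · simp only [plaquette12, Pi.single_apply]
      split_ifs
      · rw [Nat.abs_cast]; linarith
      · simp only [abs_zero, mul_zero, zero_add]; linarith
  have hBaxis : ∀ p ∈ B, ∃ x : Site 4, (∀ k : Fin 4, k ≠ 0 → x k = 0) ∧ p = plaquette12 (d := 4) (by norm_num) x := by
    intro p hp
    rw [hB, Finset.mem_insert, Finset.mem_singleton] at hp
    rcases hp with rfl | rfl
    · exact ⟨0, fun k _ => rfl, rfl⟩
    · exact ⟨Pi.single (0 : Fin 4) (n : ℤ), fun k hk => by simp [hk], rfl⟩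
  have hBS : B ⊆ S := fun p hp => hSmem' p fun k => by have := hBcore p hp k; have := abs_nonneg (p.1 k); linarith
  /- ### the truncated Green `1`-forms of the block plaquettes -/
  choose ω hωa hωb hωc hωd using fun p : ↥B => hGreen (p : ZdPlaquette 4) R (hBcore p p.2)
  have hωE : ∀ (p : ↥B) (e : ZdEdge 4), ω p e ≠ 0 → e ∈ E := fun p e he => (hEmem e).2 (hωa p e he)
  have hES : ∀ e ∈ E, plaquettesTouching {e} ⊆ S := fun e he =>
    Resum.plaquettesTouching_subset_box ((hEmem e).1 he) hSmem'
  have hωB : ∀ p q : ↥B, plaquetteCurl (ω p) (q : ZdPlaquette 4) = curvatureTwoPoint (p : ZdPlaquette 4) (q : ZdPlaquette 4) :=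
    fun p q => hωc p q (hBcore q q.2)
  have hdωS : ∀ (p : ↥B) (q : ZdPlaquette 4), plaquetteCurl (ω p) q ≠ 0 → q ∈ S := by
    intro p q hq
    by_contra hqS
    exact hq (Resum.plaquetteCurl_eq_zero_of_not_box (R := R) (hωa p) q fun h => hqS (hSmem' q h))
  set W : ℝ := Cg * (1 + (R : ℝ)) ^ cg with hWdef
  have hW : ∀ p : ↥B, ∑ e ∈ E, |ω p e| ≤ W := fun p => hωb p E
  have hW0 : 0 ≤ W := by positivity
  have hωle : ∀ (p : ↥B) (e : ZdEdge 4), |ω p e| ≤ W := fun p e => Resum.abs_le_of_sum_le (hωE p) (hW p) e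
  /- ### the Schwinger–Dyson identity in resummable form -/
  set εsd : ℝ := Csd * (2 + (R : ℝ)) ^ csd * β ^ (-κsd) with hεdef
  have hε : 0 ≤ εsd := by positivity
  have hSD' : ∀ (p : ↥B) (a : Fin (lieDim r)), ∀ e ∈ E, ∀ (g : (↥S → Fin (lieDim r) → ℝ) → ℝ) (M : ℝ), 0 ≤ M →
      ContDiff ℝ 1 g → (∀ y, |g y| ≤ 1) → (∀ y, ‖fderiv ℝ g y‖ ≤ M) →
      |(∑ p' : ↥S, plaquetteCurl (fun e' => if e' = e then (1 : ℝ) else 0) (p' : ZdPlaquette 4) *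
            ∫ U, fderiv ℝ g (fun q b => plaqField r β U (q : ZdPlaquette 4) b)
              (fun q b => if q = p' ∧ b = a then (1 : ℝ) else 0) ∂μ) -
          ∫ U, g (fun q b => plaqField r β U (q : ZdPlaquette 4) b) *
            (∑ p' ∈ S, plaquetteCurl (fun e' => if e' = e then (1 : ℝ) else 0) p' * plaqField r β U p' a) ∂μ| ≤
        εsd * (1 + M) := by
    intro p a e he g M hM hg hg0 hg1
    refine (hSDβ e a S (R + 1) (hES e he) hSrad g M hM hg hg0 hg1).trans (le_of_eq ?_)
    rw [hεdef]; push_cast; ring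
  /- ### the coefficient vector `c = dω|_S` and its `ℓ¹` bound -/
  set Cc : ℝ := 4000 * Cg * (1 + (R : ℝ)) ^ (cg + 4) with hCcdef
  have hCc0 : 0 ≤ Cc := by positivity
  have hcsum : ∀ p : ↥B, ∑ q ∈ S, |plaquetteCurl (ω p) q| ≤ Cc := by
    intro p
    have h1 : ∀ q ∈ S, |plaquetteCurl (ω p) q| ≤ 4 * W := fun q _ =>
      Resum.abs_plaquetteCurl_le q fun i => hωle p _
    calc ∑ q ∈ S, |plaquetteCurl (ω p) q| ≤ ∑ _q ∈ S, 4 * W := Finset.sum_le_sum h1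
      _ = S.card * (4 * W) := by rw [Finset.sum_const, nsmul_eq_mul]
      _ ≤ 6 * (2 * ((R + 1 : ℕ) : ℝ) + 1) ^ 4 * (4 * W) := mul_le_mul_of_nonneg_right hScard (by positivity)
      _ ≤ Cc := by
          rw [hCcdef, hWdef, Real.rpow_add (by positivity), show ((4 : ℝ)) = ((4 : ℕ) : ℝ) by norm_num,
            Real.rpow_natCast]
          push_cast
          have h3 : (2 * ((R : ℝ) + 1) + 1) ^ 4 ≤ (3 * (1 + (R : ℝ))) ^ 4 :=
            pow_le_pow_left₀ (by positivity) (by linarith) 4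
          have hP : 0 ≤ Cg * (1 + (R : ℝ)) ^ cg := hW0
          nlinarith [h3, hP, pow_nonneg (show (0:ℝ) ≤ 1 + R by positivity) 4]
  have hcsum' : ∀ p : ↥B, ∑ q : ↥S, |plaquetteCurl (ω p) (q : ZdPlaquette 4)| ≤ Cc := fun p => by
    rw [Finset.sum_coe_sort S (fun q => |plaquetteCurl (ω p) q|)]; exact hcsum p
  /- ### second moments of the field on `S` -/
  have hY2 : ∀ q ∈ S, ∀ a : Fin (lieDim r), ∫ U, (plaqField r β U q a) ^ 2 ∂μ ≤ Cm * (5 * (1 + (R : ℝ))) ^ cm := by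
    intro q hq a
    refine (hFb q a).2.trans (mul_le_mul_of_nonneg_left ?_ hCm)
    refine Real.rpow_le_rpow (by positivity) ?_ hcm
    have : ∑ k : Fin 4, (|q.1 k| : ℝ) ≤ ∑ _k : Fin 4, ((R : ℝ) + 1) :=
      Finset.sum_le_sum fun k _ => by have := hSrad q hq k; exact_mod_cast this
    simp only [Finset.sum_const, Finset.card_univ, Fintype.card_fin, nsmul_eq_mul] at this
    push_cast at this
    linarith
  set Λ : ℝ := (lieDim r : ℝ) * (Cm * (5 * (1 + (R : ℝ))) ^ cm) * (2 + 3 * Cc ^ 2) with hΛdef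
  have hΛ0 : 0 ≤ Λ := by positivity
  /- ### the harmonic background of each block plaquette -/
  have hs_eq : ∀ p : ↥B, curvatureTwoPoint (p : ZdPlaquette 4) (p : ZdPlaquette 4) = (1 / 2 : ℝ) := fun p => by
    rw [curvatureTwoPoint_self (by norm_num)]; norm_num
  set εb : ℝ := 2 * |Cb| * β ^ (-κ) with hεbdef
  set η : ℝ := W * (εsd * (δ ^ (-(1 / 2 : ℝ)) + ((lieDim r : ℝ) + 2) * (1 + Cc))) + 3 * (Cg * (1 + (R : ℝ)) ^ (-γ))
    with hηdef
  set ξ : ℝ := lam * (εb + 3 * (lieDim r : ℝ) * η + 1 / 2 * δ * Λ * ((lieDim r : ℝ) / 2 + 1)) + lam⁻¹ + Real.sqrt δ * Λ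
    with hξdef
  have hX : ∀ (p : ↥B) (a : Fin (lieDim r)),
      ∫ U, |plaqField r β U (p : ZdPlaquette 4) a - ∑ q ∈ S, plaquetteCurl (ω p) q * plaqField r β U q a| ∂μ ≤ ξ := by
    intro p a₀
    -- budget for the block plaquette
    have hbudget : ∫ U, ∑ a : Fin (lieDim r), (plaqField r β U (p : ZdPlaquette 4) a) ^ 2 ∂μ ≤
        (lieDim r : ℝ) * (1 / 2 : ℝ) + εb := by
      obtain ⟨x, hx, hpx⟩ := hBaxis p p.2
      have hcost := hbud x 1 2 (by decide)
      have icost : Integrable (fun U => (r.N : ℝ) - plaquetteObs r.ρ x 1 2 U) μ :=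
        TangentPlaquetteEnergy.integrable_sub_plaquetteObs r.ρ r.continuous r.mem_unitary μ x 1 2
      have icost2 : Integrable (fun U => 2 * β * ((r.N : ℝ) - plaquetteObs r.ρ x 1 2 U)) μ := icost.const_mul _
      have iL : Integrable (fun U => ∑ a : Fin (lieDim r), (plaqField r β U (p : ZdPlaquette 4) a) ^ 2) μ :=
        integrable_finsetSum Finset.univ fun a _ => (hFb _ a).1
      rw [hpx] at iL ⊢
      calc ∫ U, ∑ a, (plaqField r β U (plaquette12 (d := 4) (by norm_num) x) a) ^ 2 ∂μ
          ≤ ∫ U, 2 * β * ((r.N : ℝ) - plaquetteObs r.ρ x 1 2 U) ∂μ := integral_mono iL icost2 (hFa x hx)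
        _ = 2 * (β * ∫ U, ((r.N : ℝ) - plaquetteObs r.ρ x 1 2 U) ∂μ) := by rw [integral_const_mul]; ring
        _ ≤ 2 * ((lieDim r : ℝ) / 4 + |Cb| * β ^ (-κ)) := by
            have h := (abs_le.1 hcost).2
            have h' : Cb * β ^ (-κ) ≤ |Cb| * β ^ (-κ) :=
              mul_le_mul_of_nonneg_right (le_abs_self _) (Real.rpow_nonneg hβ0.le _)
            linarith
        _ = (lieDim r : ℝ) * (1 / 2 : ℝ) + εb := by rw [hεbdef]; ring
    have hΔb : |(∑ q ∈ S, (plaquetteCurl (ω p) q) ^ 2) - (1 / 2 : ℝ)| ≤ Cg * (1 + (R : ℝ)) ^ (-γ) := by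
      rw [← hs_eq p]; exact hωd p S (hdωS p)
    have hY2' : ∀ q ∈ S, ∀ a : Fin (lieDim r),
        Integrable (fun U => (plaqField r β U q a) ^ 2) μ ∧ ∫ U, (plaqField r β U q a) ^ 2 ∂μ ≤ Cm * (5 * (1 + (R : ℝ))) ^ cm :=
      fun q hq a => ⟨(hFb q a).1, hY2 q hq a⟩
    have h := background_bound r hβ0 μ S E (ω p) (hωE p) (p : ZdPlaquette 4) (hBS p.2) hε (hSD' p) (hW p) hW0
      (s := (1 / 2 : ℝ)) (by norm_num) ((hωB p p).trans (hs_eq p)) hΔb hCc0 (hcsum p) hY2' hbudget hδ hδ1 hlam a₀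
    refine h.trans (le_of_eq ?_)
    rw [hξdef, hηdef, hΛdef]
  /- ### the generator step -/
  have hgen := AssemblyGen.abs_integral_generator_le r β μ S B hBS (fun _ => E) ω hωE hωB hε hSD' hW hX F hM hF hF1 hF2
  have hcard : (B.card : ℝ) ≤ 2 := by
    rw [hB]
    exact_mod_cast (Finset.card_insert_le _ _).trans (by simp)
  refine hgen.trans ?_
  have hinner : 0 ≤ W * (εsd * (1 + M)) + ξ := by
    have hη0 : 0 ≤ η := by positivity
    have : 0 ≤ ξ := by rw [hξdef]; positivity
    positivity
  have hstep : (B.card * lieDim r : ℝ) * (W * (εsd * (1 + M)) + ξ) ≤ 2 * (lieDim r : ℝ) * (W * (εsd * (1 + M)) + ξ) :=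
    mul_le_mul_of_nonneg_right (mul_le_mul_of_nonneg_right hcard hD0) hinner
  exact hstep

end AssemblyMain

end Summit.QuantumFields.YangMills.Cruxes.FreeProbeLawG.SteinFree

end
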